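import Summits.HodgeConjecture.HodgeConjecture.Theorems.F0P3SpectralPacketHTrace   -- ★ (N) FILE 3h p842675: `SpectralPacketH.trFinAt`, (TF-1)-H `UnramTraceOneH`, `trH` (+ ★ 3g `SpectralPacketH`, ★ 1 `trPktH`, `xiH`, `unr`)
import HarnessLib

/-!
# (N) DEFS, FILE 3yH — THE `H`-SIDE UNRAMIFIED NORMALISATION STATED RELATIVE TO THE `νH`-VOLUME: (KH3′) `SpectralPacketH.UnramTraceVolH ρ νH`
# («`Tr ρ_v(1_{K_{H,v}}) = vol_{νH_v}(K_{H,v})`» — print-true for EVERY Haar `νH`), and (TF-1)-H `UnramTraceOneH` DERIVED from it under «`vol(K_{H,v}) = 1`» (Rogawski §13.3 p. 203 l. 1–3; §4.3 p. 44)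

Cell `hodgecm-mathlib` (D-0151), F0∕P3 «U3-mult», crux H413 (`stmt-HodgeConjecture-24833`), route of record `HCCMUnconditional`.  (N) lead pen F0P3a-p01 (g14); REF1 (g23) m02
LIFT CONDITION (g1) H-side ∕ (o-ν′) (REF1 (g22) m16, ref1 R1-391 (c)): the ABSOLUTE kit law (KH3) «`∀ ρ, ρ.UnramTraceOneH νH`» inside LETTER 1's `∃ kits` is νH-scaling-unsafe (false at
`2·νH_{v₀}`); desk F0P3-plan D35 (13) (a): binder 34 `hvolH` (= the witness field `Rung0WitnessS.hKH` VERBATIM, named by pen F0P3-p04 (g11) 13:02:33Z) is admitted, and «failing that,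
the H-side rows are restated relative to `νH`-volumes».  THIS FILE does both at once: the KIT LAW becomes the volume-relative (KH3′) `UnramTraceVolH` — a statement about the kit's
`H_v`-packets that holds for every Haar measure (the `K_{H,v}`-fixed dimensions over the packet `ρ_v` whose `ξ_H`-image is unramified sum to `1` [p. 203 l. 1–3: `⟨ρ_v, π_v⁰⟩ = 1`,
Thm. 13.1.1 (2) at `f = 1_{K_v} ↔ f^H = 1_{K_{H,v}}`, §4.3 p. 44]) — and (TF-1)-H `UnramTraceOneH νH` (what ★ 3h′∕3n∕3p∕3u-H∕3x consume) is the one-line CONSEQUENCE under `hvolH`.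
Definition lane (one `def … : Prop`) + read-backs; namespace of ★ FILE 3g∕3h (`…F0P3SpectralPacket.SpectralPacketH`); box-before-file; `--supports stmt-HodgeConjecture-24833 --as helper`.
No instance, no notation, no named fact, no `sorry`.
HONEST LABEL: HC_CM is proved only modulo the printed citations until rung 0 closes; this file proves no printed statement — it re-states one kit law scale-invariantly and derives the
normalised form from the witness's normalisation.

CONTENTS.
* §1 (KH3′) **`SpectralPacketH.UnramTraceVolH ρ νH`** := `∀ v, unr (ξ_H ρ_v) → ρ.trFinAt v (νH v) 1_{K_{2,v} × K_{1,v}} = (νH v).real (K_{2,v} ×ˢ K_{1,v})`; `unramTraceVolH_iff`.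
* §2 **`UnramTraceVolH.unramTraceOneH (h) (hvolH : ∀ v, (νH v).real (K_{2,v} ×ˢ K_{1,v}) = 1) : ρ.UnramTraceOneH νH`**; the same from the witness's ENNReal∕`Subgroup.prod` text
  **`UnramTraceVolH.unramTraceOneH_of_prod (h) (hKH : ∀ v, νH v ↑(K_{2,v}.prod K_{1,v}) = 1)`** (= `Rung0WitnessS.hKH` VERBATIM up to the carrier abbreviation); the converse
  `UnramTraceOneH.unramTraceVolH (hvolH)` (under the normalisation the two texts are equivalent: `unramTraceVolH_iff_unramTraceOneH`).

References: [Rogawski1990] §13.3 p. 203 l. 1–3, §13.1 Thm. 13.1.1 (2) p. 198, §4.3 p. 44, §5.4 p. 72; [CartierCorvallis1979] §IV.1.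
-/

set_option autoImplicit false
-- the mandated namespace repeats `HodgeConjecture.HodgeConjecture`, as in every `Theorems/*.lean` of this sub-problem
set_option linter.dupNamespace false

noncomputable section

open NumberField IsDedekindDomain MeasureTheory
open scoped Matrix MatrixGroups

open Literature.NumberTheory Literature.NumberTheory.Automorphic Literature.NumberTheory.Automorphic.UnitaryGroup
open Literature.NumberTheory.Rogawski1990 Literature.NumberTheory.GaloisRepresentations
open Literature.RepresentationTheory.BorelWallach2000 Literature.RepresentationTheory.KonnoKonno2007
open Summit.HodgeConjecture.HodgeConjecture.Cruxes.H413.F0P3InnerFormClassificationV6 (splitForm)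
open Summit.HodgeConjecture.HodgeConjecture.Cruxes.H413.F0P3ArchPacketKit

namespace Summit.HodgeConjecture.HodgeConjecture.Cruxes.H413.F0P3SpectralPacket

open Summit.HodgeConjecture.HodgeConjecture.Cruxes.H413.F0P3GlobalPacket
open Summit.HodgeConjecture.HodgeConjecture.Cruxes.H413.F0P3LocalPacketKit

variable {L : Type} [Field L] [NumberField L] [IsCMField L] {H' : Matrix (Fin 3) (Fin 3) L}
  {𝔩 : ∀ v : HeightOneSpectrum (𝓞 ↥(maximalRealSubfield L)), LocalPacketKit L H' v} {𝔞 : ArchPacketKit} {𝔞H : ArchPacketKitH 𝔞}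
  {DiscH : GlobalPacketH 𝔩 → 𝔞H.PktInfH → Prop}

namespace SpectralPacketH

variable [∀ v : HeightOneSpectrum (𝓞 ↥(maximalRealSubfield L)), MeasurableSpace ((cmDatum L 2 (splitForm L 2)).Local v × (cmDatum L 1 (splitForm L 1)).Local v)]

/-! ## §1 (KH3′) the volume-relative unramified normalisation [p. 203 l. 1–3] -/

/-- **(KH3′) `ρ.UnramTraceVolH νH` — «`Tr ρ_v(1_{K_{H,v}}) = vol_{νH_v}(K_{H,v})` AT EVERY PLACE WHERE `ξ_H(ρ_v)` IS UNRAMIFIED»**: the `H`-side unramified normalisation (TF-1)-H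
(★ 3h `UnramTraceOneH`: `… = 1`) STATED RELATIVE TO THE VOLUME, hence true for every Haar measure `νH_v` on `H_v = U(2) × U(1)` (it says that the `K_{H,v}`-fixed dimensions
over the members of `ρ_v` sum to `1`: print p. 203 l. 1–3 «`⟨ρ_v, π_v⁰⟩ = 1`» with Thm. 13.1.1 (2) at the unit elements).  The kit-law text of `TupleKitLaws′` (BOARD rev. 7);
★ consumers read (TF-1)-H through §2 under binder 34 `hvolH`. [cite: Rogawski1990, §13.3 p. 203 l. 1–3; §13.1 Thm. 13.1.1 (2) p. 198; §4.3 p. 44] -/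
def UnramTraceVolH (ρ : SpectralPacketH 𝔩 𝔞 𝔞H DiscH)
    (νH : ∀ v : HeightOneSpectrum (𝓞 ↥(maximalRealSubfield L)), Measure ((cmDatum L 2 (splitForm L 2)).Local v × (cmDatum L 1 (splitForm L 1)).Local v)) : Prop :=
  ∀ v : HeightOneSpectrum (𝓞 ↥(maximalRealSubfield L)), (𝔩 v).unr ((𝔩 v).xiH (ρ.fin.loc v)) →
    ρ.trFinAt v (νH v) ((((cmLocalIntegralLevel L 2 (splitForm L 2) v : Set ((cmDatum L 2 (splitForm L 2)).Local v)) ×ˢ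
      (cmLocalIntegralLevel L 1 (splitForm L 1) v : Set ((cmDatum L 1 (splitForm L 1)).Local v)))).indicator fun _ => 1) =
      (νH v).real (((cmLocalIntegralLevel L 2 (splitForm L 2) v : Set ((cmDatum L 2 (splitForm L 2)).Local v)) ×ˢ
        (cmLocalIntegralLevel L 1 (splitForm L 1) v : Set ((cmDatum L 1 (splitForm L 1)).Local v))))

/-- Unfolding of (KH3′). [cite: Rogawski1990, §13.3 p. 203 l. 1–3] -/
theorem unramTraceVolH_iff (ρ : SpectralPacketH 𝔩 𝔞 𝔞H DiscH)
    (νH : ∀ v : HeightOneSpectrum (𝓞 ↥(maximalRealSubfield L)), Measure ((cmDatum L 2 (splitForm L 2)).Local v × (cmDatum L 1 (splitForm L 1)).Local v)) :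
    ρ.UnramTraceVolH νH ↔ ∀ v : HeightOneSpectrum (𝓞 ↥(maximalRealSubfield L)), (𝔩 v).unr ((𝔩 v).xiH (ρ.fin.loc v)) →
      ρ.trFinAt v (νH v) ((((cmLocalIntegralLevel L 2 (splitForm L 2) v : Set ((cmDatum L 2 (splitForm L 2)).Local v)) ×ˢ
        (cmLocalIntegralLevel L 1 (splitForm L 1) v : Set ((cmDatum L 1 (splitForm L 1)).Local v)))).indicator fun _ => 1) =
        (νH v).real (((cmLocalIntegralLevel L 2 (splitForm L 2) v : Set ((cmDatum L 2 (splitForm L 2)).Local v)) ×ˢ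
          (cmLocalIntegralLevel L 1 (splitForm L 1) v : Set ((cmDatum L 1 (splitForm L 1)).Local v)))) :=
  Iff.rfl

/-! ## §2 (TF-1)-H from (KH3′) under the normalisation `vol(K_{H,v}) = 1` [§4.3 p. 44] -/

variable {ρ : SpectralPacketH 𝔩 𝔞 𝔞H DiscH}
  {νH : ∀ v : HeightOneSpectrum (𝓞 ↥(maximalRealSubfield L)), Measure ((cmDatum L 2 (splitForm L 2)).Local v × (cmDatum L 1 (splitForm L 1)).Local v)}

/-- **(TF-1)-H DERIVED — (KH3′) + «`vol_{νH_v}(K_{H,v}) = 1`» (binder 34 `hvolH`, `.real` text) give ★ 3h `ρ.UnramTraceOneH νH`.** [cite: Rogawski1990, §13.3 p. 203 l. 1–3; §4.3 p. 44] -/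
theorem UnramTraceVolH.unramTraceOneH (h : ρ.UnramTraceVolH νH)
    (hvolH : ∀ v : HeightOneSpectrum (𝓞 ↥(maximalRealSubfield L)),
      (νH v).real (((cmLocalIntegralLevel L 2 (splitForm L 2) v : Set ((cmDatum L 2 (splitForm L 2)).Local v)) ×ˢ
        (cmLocalIntegralLevel L 1 (splitForm L 1) v : Set ((cmDatum L 1 (splitForm L 1)).Local v)))) = 1) :
    ρ.UnramTraceOneH νH := fun v hv => by
  rw [h v hv, hvolH v, Complex.ofReal_one]

/-- **(TF-1)-H DERIVED FROM THE WITNESS'S OWN TEXT** — (KH3′) + «`νH_v ↑(K_{2,v}.prod K_{1,v}) = 1`» (the field `Rung0WitnessS.hKH` of the closer's companion VERBATIM, ENNReal on the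
subgroup product; binder 34 `hvolH` of the TUPLE letters) give `ρ.UnramTraceOneH νH`. [cite: Rogawski1990, §13.3 p. 203 l. 1–3; §4.3 p. 44] -/
theorem UnramTraceVolH.unramTraceOneH_of_prod (h : ρ.UnramTraceVolH νH)
    (hKH : ∀ v : HeightOneSpectrum (𝓞 ↥(maximalRealSubfield L)),
      νH v (((cmLocalIntegralLevel L 2 (Matrix.of fun i j : Fin 2 => if i.val + j.val + 1 = 2 then (1 : L) else 0) v).prod
          (cmLocalIntegralLevel L 1 (Matrix.of fun i j : Fin 1 => if i.val + j.val + 1 = 1 then (1 : L) else 0) v) :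
            Subgroup ((cmDatum L 2 (splitForm L 2)).Local v × (cmDatum L 1 (splitForm L 1)).Local v)) :
          Set ((cmDatum L 2 (splitForm L 2)).Local v × (cmDatum L 1 (splitForm L 1)).Local v)) = 1) :
    ρ.UnramTraceOneH νH :=
  h.unramTraceOneH fun v => by rw [measureReal_def, ← Subgroup.coe_prod, hKH v, ENNReal.toReal_one]

/-- The converse: under the normalisation, (TF-1)-H gives (KH3′). [cite: Rogawski1990, §13.3 p. 203 l. 1–3; §4.3 p. 44] -/
theorem UnramTraceOneH.unramTraceVolH (h : ρ.UnramTraceOneH νH)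
    (hvolH : ∀ v : HeightOneSpectrum (𝓞 ↥(maximalRealSubfield L)),
      (νH v).real (((cmLocalIntegralLevel L 2 (splitForm L 2) v : Set ((cmDatum L 2 (splitForm L 2)).Local v)) ×ˢ
        (cmLocalIntegralLevel L 1 (splitForm L 1) v : Set ((cmDatum L 1 (splitForm L 1)).Local v)))) = 1) :
    ρ.UnramTraceVolH νH := fun v hv => by
  rw [h v hv, hvolH v, Complex.ofReal_one]

/-- Under the normalisation `vol(K_{H,v}) = 1` the two texts (KH3′) and (TF-1)-H are equivalent. [cite: Rogawski1990, §13.3 p. 203 l. 1–3; §4.3 p. 44] -/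
theorem unramTraceVolH_iff_unramTraceOneH
    (hvolH : ∀ v : HeightOneSpectrum (𝓞 ↥(maximalRealSubfield L)),
      (νH v).real (((cmLocalIntegralLevel L 2 (splitForm L 2) v : Set ((cmDatum L 2 (splitForm L 2)).Local v)) ×ˢ
        (cmLocalIntegralLevel L 1 (splitForm L 1) v : Set ((cmDatum L 1 (splitForm L 1)).Local v)))) = 1) :
    ρ.UnramTraceVolH νH ↔ ρ.UnramTraceOneH νH :=
  ⟨fun h => h.unramTraceOneH hvolH, fun h => h.unramTraceVolH hvolH⟩

end SpectralPacketH

end Summit.HodgeConjecture.HodgeConjecture.Cruxes.H413.F0P3SpectralPacket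

end
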